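import Literature.MathematicalPhysics.QuantumFieldTheory.YangMillsOS
import Literature.MathematicalPhysics.QuantumFieldTheory.WilsonTransferKernel
import Literature.MathematicalPhysics.QuantumFieldTheory.SlabTransferKernel
import HarnessLib

/-!
# Stub `stub_wilsonStepReversal` (R4) for the crux `WeakCouplingHypercubicLimit` (line `Sketch`)

Time-reversal symmetry of the one-step Boltzmann factor of Wilson's lattice gauge theory on `(ℤ/N)⁴`
sliced across Euclidean time (Osterwalder–Seiler 1978 §§2–3; Lüscher 1977; Seiler LNP 159 Ch. 2), for a
faithful unitary `r : LatticeRep G` on a compact group `G`: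
* (a) inverting the temporal links swaps the two slices of the temporal plaquette energy,
  `S_tm(U, g⁻¹, U') = S_tm(U', g, U)`: `S_tm = 3 n N³ − elecSum` (`SlabTransferKernel.elecSum`) and
  `elecSum_swap_inv` (`Re tr ρ(h⁻¹) = Re tr ρ(h)` for unitary `ρ(h)`, cyclicity of the trace);
* (b) pointwise inversion `g ↦ (x ↦ (g x)⁻¹)` of the temporal links is measurable;
* (c) it preserves their product Haar probability measure: the Haar probability measure of a compact
  group is inversion invariant (`haarProbability.instIsInvInvariant`, compact groups are unimodular) and
  `MeasureTheory.measurePreserving_pi` assembles the coordinatewise statement.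
-/

noncomputable section

open MeasureTheory
open Literature.MathematicalPhysics.QuantumFieldTheory

namespace Summit.QuantumFields.YangMills.Theorems.WeakCouplingHypercubicLimit.TraceNormColdPressure

section Lattice

variable {G : Type*} [Group G] {n : ℕ} (ρ : G →* Matrix (Fin n) (Fin n) ℂ) {N : ℕ} [NeZero N]

/-- `S_tm = n · 3N³ − elecSum` (the temporal plaquette sum of `SlabTransferKernel`). [folklore] -/
private theorem sliceTemporalAction_eq_const_sub_elecSum (U : GaugeConfig 3 N G) (g : Site 3 N → G)
    (U' : GaugeConfig 3 N G) :
    sliceTemporalAction ρ U g U' = (∑ _x : Site 3 N, ∑ _i : Fin 3, (n : ℝ)) - elecSum ρ U g U' := by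
  simp only [sliceTemporalAction, elecSum, Finset.sum_sub_distrib]
  rfl

/-- **Time reversal of the temporal plaquette energy**: `S_tm(U, g⁻¹, U') = S_tm(U', g, U)` for a unitary
representation `ρ` (`elecSum_swap_inv`). [folklore] -/
private theorem sliceTemporalAction_inv_swap (hρu : ∀ g, ρ g ∈ Matrix.unitaryGroup (Fin n) ℂ)
    (U U' : GaugeConfig 3 N G) (g : Site 3 N → G) :
    sliceTemporalAction ρ U (fun x => (g x)⁻¹) U' = sliceTemporalAction ρ U' g U := by
  rw [sliceTemporalAction_eq_const_sub_elecSum, sliceTemporalAction_eq_const_sub_elecSum]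
  exact congrArg _ (elecSum_swap_inv ρ hρu U' U g)

end Lattice

/-- `stub_wilsonStepReversal` (R4, r8) — **time-reversal symmetry of Wilson's one-step Boltzmann factor.**  For a
faithful unitary `r : LatticeRep G`: (a) inverting the temporal links swaps the two slices of the temporal plaquette
energy, `S_tm(U, g⁻¹, U') = S_tm(U', g, U)` (`Re tr ρ(h⁻¹) = Re tr ρ(h)` for unitary `ρ(h)`, cyclicity of the trace);
(b) pointwise inversion of the temporal links preserves their product Haar measure (compact groups are unimodular).
Cf. `SlabTransferKernel.elecSum_swap_inv` / `sliceKernel_symm` for the finite-temperature configuration type. [folklore] -/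
theorem stub_wilsonStepReversal :
    ∀ (G : Type) [Group G] [TopologicalSpace G] [IsTopologicalGroup G] [CompactSpace G]
      [MeasurableSpace G] [BorelSpace G] (r : LatticeRep G) (N : ℕ) [NeZero N],
      (∀ (U U' : GaugeConfig 3 N G) (g : Site 3 N → G),
          sliceTemporalAction r.ρ U (fun x => (g x)⁻¹) U' = sliceTemporalAction r.ρ U' g U) ∧
      Measurable (fun g : Site 3 N → G => fun x => (g x)⁻¹) ∧
      MeasurePreserving (fun g : Site 3 N → G => fun x => (g x)⁻¹)
        (Measure.pi fun _ : Site 3 N => haarProbability G) (Measure.pi fun _ : Site 3 N => haarProbability G) := by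
  intro G _ _ _ _ _ _ r N _
  exact ⟨fun U U' g => sliceTemporalAction_inv_swap r.ρ r.mem_unitary U U' g,
    measurable_pi_lambda _ fun x => (measurable_pi_apply x).inv,
    measurePreserving_pi (fun _ : Site 3 N => haarProbability G) (fun _ : Site 3 N => haarProbability G)
      fun _ => Measure.measurePreserving_inv (haarProbability G)⟩

end Summit.QuantumFields.YangMills.Theorems.WeakCouplingHypercubicLimit.TraceNormColdPressure

end
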